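import Literature.NumberTheory.LFunctions.FundamentalConeBoundary
import Literature.Algebra.EuclideanLattices.WeightedLatticeSums
import HarnessLib

/-!
# Twisted lattice sums over the sign parts of the fundamental cone (Hecke, Mitsui)

Topic `Literature/NumberTheory/LFunctions`, next to `FundamentalConeBoundary.lean` (the frontier
of Mathlib's norm-one fundamental domain `normLeOne K` is Lipschitz parametrizable) and
`IdealCountProofs.lean` (the ideal count `I_K(x) = ρ_K x + O(x^{1−1/d})`). Everything in this
file is PROVED (definitions with bodies + theorems; no named facts).

For a number field `K` of degree `d` with Mathlib's fundamental cone `𝓒` (a fundamental domain for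
the unit group modulo torsion acting on the mixed space `ℝ^{r₁} × ℂ^{r₂}`), the **cone
coordinates** `c(x) ∈ ℝ^{rank}` of `x` are the coordinates of `logMap x` in the basis of the unit
lattice (`coneCoord`; `x ∈ 𝓒 ⟺ N(x) ≠ 0 ∧ c(x) ∈ [0,1)^{rank}`), and for a frequency
`m ∈ ℝ^{rank}` the **twist** is `e_m(x) = exp(2πi m · c(x))` (`eTwist`) — on principal ideals these
are Hecke's Grössencharaktere of conductor `1` (E. Hecke, Math. Z. 6 (1920); T. Mitsui,
*Generalized prime number theorem*, Jap. J. Math. 26 (1956), §1).  For a set `s` of real places,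
`signPart K s = negAt s '' plusPart (normLeOne K)` is the part of the norm-one domain with negative
real coordinates exactly at `s` (Mathlib's `negAt`, `plusPart`; the tree's `RayClassLSeriesAtOneProofs`
counts untwisted lattice points in the same pieces, written `normLeOne K ∩ signCone K ε` there).

Main results (the geometric input of the prime number theorem for Grössencharaktere):

* `coneConst_mul_norm_le_normAtPlace` — on the cone all coordinates are comparable:
  `c_K ‖x‖ ≤ |x_w|` for `x ∈ 𝓒` (the log-coordinates are bounded);
* `norm_eTwist_sub_eTwist_le` — `|e_m(x) − e_m(y)| ≤ A_m ‖x − y‖/η` for `x, y ∈ 𝓒` with all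
  coordinates `≥ η`;
* `frontier_signPart_subset`, `lipschitzFrontier_signPart` — the frontier of a sign part lies in
  the frontier of `normLeOne K`, hence is Lipschitz parametrizable;
* **`norm_sum_eTwist_sub_le`** — for a full lattice `L` of the mixed space, a set of real places
  `s` and a frequency `m` there is `C` with, for all `t ≥ 1`,
  `‖∑_{ℓ ∈ L ∩ t • signPart s} e_m(ℓ) − (V_s(m)/covol L) t^d‖ ≤ C t^{d − 1/2}`,
  `V_s(m) = ∫_{signPart s} e_m` (`twistIntegral`): Marcus's cell count with the weight `e_m`
  (`WeightedLatticeSums.norm_sum_sub_integral_le_of_cover`), the oscillation of `e_m` on a cell at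
  distance `ρ` from the origin being `O(1/ρ)`.

The evaluation of `V_s(m)` (independent of `s`; `= regulator` for `m = 0` and `0` for integral
`m ≠ 0`, `K` totally real) is the subject of the sequel `TwistedConeIntegral.lean`.

## References

* E. Hecke, *Eine neue Art von Zetafunktionen und ihre Beziehungen zur Verteilung der
  Primzahlen II*, Math. Z. 6 (1920), 11–51, §§1–2. [HeckeMathZ1920]
* T. Mitsui, *Generalized prime number theorem*, Jap. J. Math. 26 (1956), 1–42, §1.
  [cite: Mitsui1956, §1]
* D. A. Marcus, *Number Fields*, 2nd ed. (2018), Ch. 6, Lemma 2 and pp. 125–129. [Marcus2018]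

## Mathlib / tree search

Mathlib: `fundamentalCone`, `normLeOne`, `logMap`, `basisUnitLattice`, `negAt`, `plusPart`,
`volume_preserving_negAt`, `normAtPlace_negAt`, `norm_eq_sup'_normAtPlace`, `logMap_real_smul`,
`ZSpan.norm_fract_le`, `Measure.setIntegral_comp_smul_of_pos`. Tree:
`NumberField.lipschitzFrontier_normLeOne` (`FundamentalConeBoundary`),
`EuclideanLattices.norm_sum_sub_integral_le_of_cover`, `LipschitzFrontier.exists_cover`,
`card_le_of_cell_inter_closedBall` (`LatticePointCounting`, `WeightedLatticeSums`).
-/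

noncomputable section

open NumberField NumberField.InfinitePlace NumberField.mixedEmbedding
  NumberField.mixedEmbedding.fundamentalCone NumberField.Units NumberField.Units.dirichletUnitTheorem
  MeasureTheory Module Submodule Bornology Set Metric Finset
open scoped Real NNReal ENNReal Pointwise Classical

namespace Literature.NumberTheory.LFunctions.HeckeCone

variable (K : Type*) [Field K] [NumberField K]

/-! ## Cone coordinates and the twist -/

/-- The real basis of the log-space made of the unit-lattice basis (Mathlib's basis whose
fundamental parallelepiped defines the fundamental cone). [folklore] -/
abbrev logBasis : Basis (Fin (rank K)) ℝ (logSpace K) :=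
  (basisUnitLattice K).ofZLatticeBasis ℝ (unitLattice K)

variable {K}

/-- **Cone coordinates**: the coordinates of `logMap x` in the unit-lattice basis; `x` lies in the
fundamental cone iff `N(x) ≠ 0` and all cone coordinates lie in `[0, 1)` (`mem_fundamentalCone_iff`).
[cite: Mitsui1956, §1] -/
def coneCoord (x : mixedSpace K) : Fin (rank K) → ℝ := fun i ↦ (logBasis K).repr (logMap x) i

/-- Membership in the fundamental cone through the cone coordinates. [folklore] -/
theorem mem_fundamentalCone_iff {x : mixedSpace K} :
    x ∈ fundamentalCone K ↔ mixedEmbedding.norm x ≠ 0 ∧ ∀ i, coneCoord x i ∈ Set.Ico (0 : ℝ) 1 := by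
  rw [fundamentalCone, Set.mem_sdiff, Set.mem_preimage, ZSpan.mem_fundamentalDomain, Set.mem_setOf_eq]
  exact ⟨fun h ↦ ⟨h.2, h.1⟩, fun h ↦ ⟨h.2, h.1⟩⟩

/-- The cone coordinates depend only on the absolute values of the coordinates. [folklore] -/
theorem coneCoord_eq_of_normAtPlace_eq {x y : mixedSpace K} (h : ∀ w, normAtPlace w x = normAtPlace w y) :
    coneCoord x = coneCoord y := by
  unfold coneCoord; rw [logMap_eq_of_normAtPlace_eq h]

/-- The cone coordinates are invariant under nonzero real scalings (`N(x) ≠ 0`). [folklore] -/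
theorem coneCoord_smul {x : mixedSpace K} (hx : mixedEmbedding.norm x ≠ 0) {c : ℝ} (hc : c ≠ 0) :
    coneCoord (c • x) = coneCoord x := by
  unfold coneCoord; rw [logMap_real_smul hx hc]

/-- The cone coordinates are measurable. [folklore] -/
theorem measurable_coneCoord : Measurable (coneCoord : mixedSpace K → Fin (rank K) → ℝ) := by
  have hlog : Measurable (logMap : mixedSpace K → logSpace K) := by
    unfold logMap
    refine measurable_pi_iff.mpr fun w ↦ measurable_const.mul ?_
    exact (continuous_normAtPlace _).measurable.log.sub <|
      (mixedEmbedding.continuous_norm _).measurable.log.mul measurable_const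
  unfold coneCoord
  refine measurable_pi_iff.mpr fun i ↦ ?_
  exact ((logBasis K).coord i).continuous_of_finiteDimensional.measurable.comp hlog

/-- **The twist** `e_m(x) = exp(2πi ∑_i m_i c_i(x))` attached to a frequency vector `m`
(a Grössencharakter of conductor `1` evaluated at a generator in the cone).
[cite: HeckeMathZ1920, §1] -/
def eTwist (m : Fin (rank K) → ℝ) (x : mixedSpace K) : ℂ :=
  Complex.exp (2 * π * Complex.I * (∑ i, m i * coneCoord x i : ℝ))

/-- `|e_m(x)| = 1`. [folklore] -/
theorem norm_eTwist (m : Fin (rank K) → ℝ) (x : mixedSpace K) : ‖eTwist m x‖ = 1 := by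
  unfold eTwist
  rw [Complex.norm_exp]
  simp [Complex.mul_re, Complex.I_re, Complex.I_im]

/-- `e_m` depends only on the absolute values of the coordinates. [folklore] -/
theorem eTwist_eq_of_normAtPlace_eq (m : Fin (rank K) → ℝ) {x y : mixedSpace K}
    (h : ∀ w, normAtPlace w x = normAtPlace w y) : eTwist m x = eTwist m y := by
  unfold eTwist; rw [coneCoord_eq_of_normAtPlace_eq h]

/-- `e_m` is invariant under nonzero real scalings. [folklore] -/
theorem eTwist_smul (m : Fin (rank K) → ℝ) {x : mixedSpace K} (hx : mixedEmbedding.norm x ≠ 0)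
    {c : ℝ} (hc : c ≠ 0) : eTwist m (c • x) = eTwist m x := by
  unfold eTwist; rw [coneCoord_smul hx hc]

/-- `e_m` is measurable. [folklore] -/
theorem measurable_eTwist (m : Fin (rank K) → ℝ) : Measurable (eTwist (K := K) m) := by
  unfold eTwist
  refine Complex.measurable_exp.comp (measurable_const.mul ?_)
  refine Complex.measurable_ofReal.comp ?_
  refine Finset.measurable_sum _ fun i _ ↦ measurable_const.mul ?_
  exact (measurable_pi_apply i).comp measurable_coneCoord

/-- `|e(a) − e(b)| ≤ 2π |a − b|` for real `a, b`. [folklore] -/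
theorem norm_cexp_sub_cexp_le (a b : ℝ) :
    ‖Complex.exp (2 * π * Complex.I * a) - Complex.exp (2 * π * Complex.I * b)‖ ≤ 2 * π * |a - b| := by
  have h : ∀ u : ℝ, Complex.exp (2 * π * Complex.I * u) = Complex.exp (Complex.I * (2 * π * u : ℝ)) := by
    intro u; congr 1; push_cast; ring
  rw [h a, h b]
  -- the chord bound `‖exp(iθ₁) − exp(iθ₂)‖ ≤ |θ₁ − θ₂|`
  have key : ‖Complex.exp (Complex.I * (2 * π * a : ℝ)) - Complex.exp (Complex.I * (2 * π * b : ℝ))‖ ≤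
      |2 * π * a - 2 * π * b| := by
    have e : Complex.exp (Complex.I * (2 * π * a : ℝ)) - Complex.exp (Complex.I * (2 * π * b : ℝ)) =
        Complex.exp (Complex.I * (2 * π * b : ℝ)) * (Complex.exp (Complex.I * ((2 * π * a - 2 * π * b : ℝ))) - 1) := by
      rw [mul_sub, mul_one, ← Complex.exp_add]
      congr 1; push_cast; ring
    have hn : ‖Complex.exp (Complex.I * (2 * π * b : ℝ))‖ = 1 := by
      rw [mul_comm]; exact Complex.norm_exp_ofReal_mul_I _
    rw [e, norm_mul, hn, one_mul]
    have := Real.norm_exp_I_mul_ofReal_sub_one_le (x := 2 * π * a - 2 * π * b)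
    rwa [Real.norm_eq_abs] at this
  calc _ ≤ |2 * π * a - 2 * π * b| := key
    _ = 2 * π * |a - b| := by
        rw [← mul_sub, abs_mul, abs_of_pos (by positivity : (0:ℝ) < 2 * π)]

/-! ## Coordinates on the cone are comparable to the norm -/

/-- The radius of the fundamental parallelepiped of the unit-lattice basis: a bound for
`‖logMap x‖`, `x` in the fundamental cone. [folklore] -/
def logRadius (K : Type*) [Field K] [NumberField K] : ℝ := ∑ i, ‖logBasis K i‖

/-- `0 ≤ R_log`. [folklore] -/
theorem logRadius_nonneg : 0 ≤ logRadius K := Finset.sum_nonneg fun _ _ ↦ norm_nonneg _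

/-- On the fundamental cone `‖logMap x‖ ≤ R_log`. [folklore] -/
theorem norm_logMap_le_of_mem {x : mixedSpace K} (hx : x ∈ fundamentalCone K) :
    ‖logMap x‖ ≤ logRadius K := by
  have hmem : logMap x ∈ ZSpan.fundamentalDomain (logBasis K) := hx.1
  rw [← (ZSpan.fract_eq_self (b := logBasis K)).2 hmem]
  exact ZSpan.norm_fract_le _ _

/-- Each log-coordinate of a cone point is within `R_log` of `(log N x)/d` (places `w ≠ w₀`).
[folklore] -/
theorem abs_log_normAtPlace_sub_le_of_ne {x : mixedSpace K} (hx : x ∈ fundamentalCone K)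
    {w : InfinitePlace K} (hw : w ≠ w₀) :
    |Real.log (normAtPlace w x) - Real.log (mixedEmbedding.norm x) * (finrank ℚ K : ℝ)⁻¹| ≤
      logRadius K := by
  have h1 := norm_logMap_le_of_mem hx
  have h2 : |logMap x ⟨w, hw⟩| ≤ ‖logMap x‖ := by
    rw [← Real.norm_eq_abs]; exact norm_le_pi_norm _ _
  rw [logMap_apply] at h2
  have h3 : |Real.log (normAtPlace w x) - Real.log (mixedEmbedding.norm x) * (finrank ℚ K : ℝ)⁻¹| ≤
      |(mult w : ℝ) * (Real.log (normAtPlace w x) - Real.log (mixedEmbedding.norm x) * (finrank ℚ K : ℝ)⁻¹)| := by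
    rw [abs_mul]
    have hm : (1 : ℝ) ≤ |(mult w : ℝ)| := by
      rw [Nat.abs_cast]; exact_mod_cast Nat.one_le_iff_ne_zero.2 mult_ne_zero
    exact le_mul_of_one_le_left (abs_nonneg _) hm
  exact h3.trans (h2.trans h1)

/-- The same at the distinguished place `w₀`, with the constant `d · R_log` (the `w₀`-coordinate is
determined by the others through `log N = ∑_w mult_w log |x_w|`). [folklore] -/
theorem abs_log_normAtPlace_sub_le {x : mixedSpace K} (hx : x ∈ fundamentalCone K)
    (w : InfinitePlace K) :
    |Real.log (normAtPlace w x) - Real.log (mixedEmbedding.norm x) * (finrank ℚ K : ℝ)⁻¹| ≤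
      (finrank ℚ K) * logRadius K := by
  have hd : (1 : ℝ) ≤ finrank ℚ K := by exact_mod_cast finrank_pos (R := ℚ) (M := K)
  have hR := logRadius_nonneg (K := K)
  by_cases hw : w = w₀
  · subst hw
    -- `∑_w mult_w (log|x_w| − log N/d) = 0`
    set D : InfinitePlace K → ℝ := fun w ↦
      (mult w : ℝ) * (Real.log (normAtPlace w x) - Real.log (mixedEmbedding.norm x) * (finrank ℚ K : ℝ)⁻¹)
      with hD
    have hpos : ∀ w, 0 < normAtPlace w x := fun w ↦ normAtPlace_pos_of_mem hx w
    have hsum : ∑ w, D w = 0 := by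
      have hlogN : Real.log (mixedEmbedding.norm x) = ∑ w, (mult w : ℝ) * Real.log (normAtPlace w x) := by
        rw [mixedEmbedding.norm_apply, Real.log_prod]
        · simp_rw [Real.log_pow]
        · intro w _; exact pow_ne_zero _ (hpos w).ne'
      simp_rw [hD, mul_sub, Finset.sum_sub_distrib, ← hlogN, ← Finset.sum_mul, ← Nat.cast_sum, sum_mult_eq]
      have hd0 : (finrank ℚ K : ℝ) ≠ 0 := by positivity
      field_simp
      ring
    have hsplit : D w₀ = -∑ w ∈ Finset.univ.erase w₀, D w := by
      rw [← Finset.add_sum_erase _ _ (Finset.mem_univ w₀)] at hsum; linarith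
    have hbound : |D w₀| ≤ ∑ w ∈ Finset.univ.erase w₀, |D w| := by
      rw [hsplit, abs_neg]; exact Finset.abs_sum_le_sum_abs _ _
    have heach : ∀ w ∈ Finset.univ.erase w₀, |D w| ≤ (mult w : ℝ) * logRadius K := by
      intro w hw'
      have hne : w ≠ w₀ := Finset.ne_of_mem_erase hw'
      rw [hD]; dsimp only
      rw [abs_mul, Nat.abs_cast]
      exact mul_le_mul_of_nonneg_left (abs_log_normAtPlace_sub_le_of_ne hx hne) (Nat.cast_nonneg _)
    have hmult : |D w₀| = (mult (w₀ : InfinitePlace K) : ℝ) * |Real.log (normAtPlace w₀ x) -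
        Real.log (mixedEmbedding.norm x) * (finrank ℚ K : ℝ)⁻¹| := by
      rw [hD]; dsimp only; rw [abs_mul, Nat.abs_cast]
    have hm1 : (1 : ℝ) ≤ mult (w₀ : InfinitePlace K) := by exact_mod_cast Nat.one_le_iff_ne_zero.2 mult_ne_zero
    calc |Real.log (normAtPlace w₀ x) - Real.log (mixedEmbedding.norm x) * (finrank ℚ K : ℝ)⁻¹|
        ≤ (mult (w₀ : InfinitePlace K) : ℝ) * |Real.log (normAtPlace w₀ x) - Real.log (mixedEmbedding.norm x) * (finrank ℚ K : ℝ)⁻¹| :=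
          le_mul_of_one_le_left (abs_nonneg _) hm1
      _ = |D w₀| := hmult.symm
      _ ≤ ∑ w ∈ Finset.univ.erase w₀, (mult w : ℝ) * logRadius K :=
          hbound.trans (Finset.sum_le_sum heach)
      _ ≤ ∑ w, (mult w : ℝ) * logRadius K :=
          Finset.sum_le_sum_of_subset_of_nonneg (Finset.erase_subset _ _) fun w _ _ ↦ by positivity
      _ = (finrank ℚ K) * logRadius K := by
          rw [← Finset.sum_mul, ← Nat.cast_sum, sum_mult_eq]
  · calc _ ≤ logRadius K := abs_log_normAtPlace_sub_le_of_ne hx hw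
      _ ≤ (finrank ℚ K) * logRadius K := le_mul_of_one_le_left hR hd

/-- The cone constant `c_K = exp(−2 d R_log) ∈ (0, 1]`. [folklore] -/
def coneConst (K : Type*) [Field K] [NumberField K] : ℝ := Real.exp (-(2 * finrank ℚ K * logRadius K))

/-- `0 < c_K`. [folklore] -/
theorem coneConst_pos : 0 < coneConst K := Real.exp_pos _

/-- `c_K ≤ 1`. [folklore] -/
theorem coneConst_le_one : coneConst K ≤ 1 := by
  unfold coneConst
  rw [Real.exp_le_one_iff, neg_nonpos]
  have := logRadius_nonneg (K := K)
  positivity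

/-- `|x_w| ≤ ‖x‖` for the sup norm of the mixed space. [folklore] -/
theorem normAtPlace_le_norm (x : mixedSpace K) (w : InfinitePlace K) : normAtPlace w x ≤ ‖x‖ := by
  rw [norm_eq_sup'_normAtPlace]
  exact Finset.le_sup' (fun w ↦ normAtPlace w x) (Finset.mem_univ w)

/-- **All coordinates of a cone point are comparable to its norm**: `c_K ‖x‖ ≤ |x_w|` for
`x ∈ 𝓒` and every place `w`. [folklore] -/
theorem coneConst_mul_norm_le_normAtPlace {x : mixedSpace K} (hx : x ∈ fundamentalCone K)
    (w : InfinitePlace K) : coneConst K * ‖x‖ ≤ normAtPlace w x := by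
  set d : ℝ := (finrank ℚ K : ℝ)
  set R := logRadius K
  set L := Real.log (mixedEmbedding.norm x) * (finrank ℚ K : ℝ)⁻¹ with hL
  have hpos : ∀ v, 0 < normAtPlace v x := fun v ↦ normAtPlace_pos_of_mem hx v
  -- every coordinate is in `[e^{L − dR}, e^{L + dR}]`
  have hup : ∀ v, normAtPlace v x ≤ Real.exp (L + d * R) := by
    intro v
    have h := (abs_le.1 (abs_log_normAtPlace_sub_le hx v)).2
    rw [← Real.exp_log (hpos v)]
    exact Real.exp_le_exp.2 (by linarith)
  have hlow : Real.exp (L - d * R) ≤ normAtPlace w x := by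
    have h := (abs_le.1 (abs_log_normAtPlace_sub_le hx w)).1
    rw [← Real.exp_log (hpos w)]
    exact Real.exp_le_exp.2 (by linarith)
  have hnorm : ‖x‖ ≤ Real.exp (L + d * R) := by
    rw [norm_eq_sup'_normAtPlace]
    exact Finset.sup'_le _ _ fun v _ ↦ hup v
  calc coneConst K * ‖x‖ ≤ Real.exp (-(2 * d * R)) * Real.exp (L + d * R) :=
        mul_le_mul_of_nonneg_left hnorm (coneConst_pos (K := K)).le
    _ = Real.exp (L - d * R) := by rw [← Real.exp_add]; congr 1; ring
    _ ≤ normAtPlace w x := hlow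

/-! ## The twist is Lipschitz on the cone away from the origin -/

/-- `|log a − log b| ≤ |a − b|/η` for `a, b ≥ η > 0`. [folklore] -/
theorem abs_log_sub_log_le {a b η : ℝ} (hη : 0 < η) (ha : η ≤ a) (hb : η ≤ b) :
    |Real.log a - Real.log b| ≤ |a - b| / η := by
  have ha0 : 0 < a := hη.trans_le ha
  have hb0 : 0 < b := hη.trans_le hb
  rw [abs_le]
  constructor
  · -- `log b − log a ≤ (b − a)/a ≤ |a−b|/η`
    have h1 : Real.log b - Real.log a ≤ (b - a) / a := by
      rw [← Real.log_div hb0.ne' ha0.ne']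
      have := Real.log_le_sub_one_of_pos (div_pos hb0 ha0)
      rwa [div_sub_one ha0.ne'] at this
    have h2 : (b - a) / a ≤ |a - b| / η := by
      calc (b - a) / a ≤ |a - b| / a := by
            gcongr; rw [abs_sub_comm]; exact le_abs_self _
        _ ≤ |a - b| / η := div_le_div_of_nonneg_left (abs_nonneg _) hη ha
    linarith
  · have h1 : Real.log a - Real.log b ≤ (a - b) / b := by
      rw [← Real.log_div ha0.ne' hb0.ne']
      have := Real.log_le_sub_one_of_pos (div_pos ha0 hb0)
      rwa [div_sub_one hb0.ne'] at this
    have h2 : (a - b) / b ≤ |a - b| / η := by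
      calc (a - b) / b ≤ |a - b| / b := by gcongr; exact le_abs_self _
        _ ≤ |a - b| / η := div_le_div_of_nonneg_left (abs_nonneg _) hη hb
    linarith

/-- `|(|x_w|) − (|y_w|)| ≤ ‖x − y‖`. [folklore] -/
theorem abs_normAtPlace_sub_normAtPlace_le (w : InfinitePlace K) (x y : mixedSpace K) :
    |normAtPlace w x - normAtPlace w y| ≤ ‖x - y‖ := by
  rw [abs_le]
  constructor
  · have h := normAtPlace_add_le w (y - x) x
    rw [sub_add_cancel] at h
    have h' : normAtPlace w (y - x) ≤ ‖x - y‖ := by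
      rw [← neg_sub, normAtPlace_neg]; exact normAtPlace_le_norm _ _
    linarith
  · have h := normAtPlace_add_le w (x - y) y
    rw [sub_add_cancel] at h
    have h' := normAtPlace_le_norm (x - y) w
    linarith

/-- `|log N(x) − log N(y)| ≤ d ‖x − y‖/η` when all coordinates of `x, y` are `≥ η > 0`. [folklore] -/
theorem abs_log_norm_sub_log_norm_le {x y : mixedSpace K} {η : ℝ} (hη : 0 < η)
    (hx : ∀ w, η ≤ normAtPlace w x) (hy : ∀ w, η ≤ normAtPlace w y) :
    |Real.log (mixedEmbedding.norm x) - Real.log (mixedEmbedding.norm y)| ≤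
      (finrank ℚ K) * (‖x - y‖ / η) := by
  have hx0 : ∀ w, 0 < normAtPlace w x := fun w ↦ hη.trans_le (hx w)
  have hy0 : ∀ w, 0 < normAtPlace w y := fun w ↦ hη.trans_le (hy w)
  have hlx : Real.log (mixedEmbedding.norm x) = ∑ w, (mult w : ℝ) * Real.log (normAtPlace w x) := by
    rw [mixedEmbedding.norm_apply, Real.log_prod]
    · simp_rw [Real.log_pow]
    · intro w _; exact pow_ne_zero _ (hx0 w).ne'
  have hly : Real.log (mixedEmbedding.norm y) = ∑ w, (mult w : ℝ) * Real.log (normAtPlace w y) := by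
    rw [mixedEmbedding.norm_apply, Real.log_prod]
    · simp_rw [Real.log_pow]
    · intro w _; exact pow_ne_zero _ (hy0 w).ne'
  rw [hlx, hly, ← Finset.sum_sub_distrib]
  calc |∑ w, ((mult w : ℝ) * Real.log (normAtPlace w x) - (mult w : ℝ) * Real.log (normAtPlace w y))|
      ≤ ∑ w, |(mult w : ℝ) * Real.log (normAtPlace w x) - (mult w : ℝ) * Real.log (normAtPlace w y)| :=
        Finset.abs_sum_le_sum_abs _ _
    _ ≤ ∑ w, (mult w : ℝ) * (‖x - y‖ / η) := by
        refine Finset.sum_le_sum fun w _ ↦ ?_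
        rw [← mul_sub, abs_mul, Nat.abs_cast]
        refine mul_le_mul_of_nonneg_left ?_ (Nat.cast_nonneg _)
        exact (abs_log_sub_log_le hη (hx w) (hy w)).trans
          (div_le_div_of_nonneg_right (abs_normAtPlace_sub_normAtPlace_le w x y) hη.le)
    _ = (finrank ℚ K) * (‖x - y‖ / η) := by rw [← Finset.sum_mul, ← Nat.cast_sum, sum_mult_eq]

/-- `‖logMap x − logMap y‖ ≤ 4 ‖x − y‖/η` when all coordinates of `x, y` are `≥ η > 0`
(`mult_w ≤ 2`, `d/d = 1`). [folklore] -/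
theorem norm_logMap_sub_logMap_le {x y : mixedSpace K} {η : ℝ} (hη : 0 < η)
    (hx : ∀ w, η ≤ normAtPlace w x) (hy : ∀ w, η ≤ normAtPlace w y) :
    ‖logMap x - logMap y‖ ≤ 4 * (‖x - y‖ / η) := by
  have hq : 0 ≤ ‖x - y‖ / η := div_nonneg (norm_nonneg _) hη.le
  rw [pi_norm_le_iff_of_nonneg (by positivity)]
  intro w
  rw [Pi.sub_apply, logMap_apply, logMap_apply, Real.norm_eq_abs, ← mul_sub, abs_mul, Nat.abs_cast]
  have hm : (mult w.1 : ℝ) ≤ 2 := by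
    have : mult w.1 ≤ 2 := by rw [mult]; split_ifs <;> norm_num
    exact_mod_cast this
  have h1 := abs_log_sub_log_le hη (hx w.1) (hy w.1)
  have h1' : |Real.log (normAtPlace w.1 x) - Real.log (normAtPlace w.1 y)| ≤ ‖x - y‖ / η :=
    h1.trans (div_le_div_of_nonneg_right (abs_normAtPlace_sub_normAtPlace_le w.1 x y) hη.le)
  have h2 := abs_log_norm_sub_log_norm_le hη hx hy
  have hd : (0 : ℝ) < finrank ℚ K := by exact_mod_cast finrank_pos (R := ℚ) (M := K)
  have h2' : |Real.log (mixedEmbedding.norm x) * (finrank ℚ K : ℝ)⁻¹ -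
      Real.log (mixedEmbedding.norm y) * (finrank ℚ K : ℝ)⁻¹| ≤ ‖x - y‖ / η := by
    rw [← sub_mul, abs_mul, abs_inv, Nat.abs_cast]
    calc _ ≤ (finrank ℚ K) * (‖x - y‖ / η) * (finrank ℚ K : ℝ)⁻¹ :=
          mul_le_mul_of_nonneg_right h2 (by positivity)
      _ = ‖x - y‖ / η := by field_simp
  have h3 : |Real.log (normAtPlace w.1 x) - Real.log (mixedEmbedding.norm x) * (finrank ℚ K : ℝ)⁻¹ -
      (Real.log (normAtPlace w.1 y) - Real.log (mixedEmbedding.norm y) * (finrank ℚ K : ℝ)⁻¹)| ≤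
      2 * (‖x - y‖ / η) := by
    have e : Real.log (normAtPlace w.1 x) - Real.log (mixedEmbedding.norm x) * (finrank ℚ K : ℝ)⁻¹ -
        (Real.log (normAtPlace w.1 y) - Real.log (mixedEmbedding.norm y) * (finrank ℚ K : ℝ)⁻¹) =
        (Real.log (normAtPlace w.1 x) - Real.log (normAtPlace w.1 y)) -
          (Real.log (mixedEmbedding.norm x) * (finrank ℚ K : ℝ)⁻¹ -
            Real.log (mixedEmbedding.norm y) * (finrank ℚ K : ℝ)⁻¹) := by ring
    rw [e]
    calc _ ≤ |Real.log (normAtPlace w.1 x) - Real.log (normAtPlace w.1 y)| +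
          |Real.log (mixedEmbedding.norm x) * (finrank ℚ K : ℝ)⁻¹ -
            Real.log (mixedEmbedding.norm y) * (finrank ℚ K : ℝ)⁻¹| := abs_sub _ _
      _ ≤ ‖x - y‖ / η + ‖x - y‖ / η := add_le_add h1' h2'
      _ = 2 * (‖x - y‖ / η) := by ring
  calc (mult w.1 : ℝ) * |Real.log (normAtPlace w.1 x) - Real.log (mixedEmbedding.norm x) * (finrank ℚ K : ℝ)⁻¹ -
        (Real.log (normAtPlace w.1 y) - Real.log (mixedEmbedding.norm y) * (finrank ℚ K : ℝ)⁻¹)|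
      ≤ 2 * (2 * (‖x - y‖ / η)) := mul_le_mul hm h3 (abs_nonneg _) (by norm_num)
    _ = 4 * (‖x - y‖ / η) := by ring


/-- The Lipschitz constant of the twist `e_m` on the cone: `A_m = 2π (∑|m_i|) ‖coord‖ · 4`.
[folklore] -/
def twistLip (m : Fin (rank K) → ℝ) : ℝ :=
  2 * π * (∑ i, |m i|) * ‖((logBasis K).equivFunL : logSpace K →L[ℝ] (Fin (rank K) → ℝ))‖ * 4

/-- `0 ≤ A_m`. [folklore] -/
theorem twistLip_nonneg (m : Fin (rank K) → ℝ) : 0 ≤ twistLip (K := K) m := by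
  unfold twistLip
  have : 0 ≤ ∑ i, |m i| := Finset.sum_nonneg fun _ _ ↦ abs_nonneg _
  positivity

/-- The cone coordinates in terms of the continuous linear coordinate map. [folklore] -/
theorem coneCoord_eq_equivFunL (x : mixedSpace K) :
    coneCoord x = (logBasis K).equivFunL (logMap x) := by
  ext i; rfl

/-- **The twist is Lipschitz away from the coordinate hyperplanes**: for `x, y` with all
coordinates `≥ η > 0`, `‖e_m(x) − e_m(y)‖ ≤ A_m ‖x − y‖ / η`. [cite: Mitsui1956, §1] -/
theorem norm_eTwist_sub_eTwist_le (m : Fin (rank K) → ℝ) {x y : mixedSpace K} {η : ℝ} (hη : 0 < η)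
    (hx : ∀ w, η ≤ normAtPlace w x) (hy : ∀ w, η ≤ normAtPlace w y) :
    ‖eTwist m x - eTwist m y‖ ≤ twistLip m * (‖x - y‖ / η) := by
  unfold eTwist
  refine (norm_cexp_sub_cexp_le _ _).trans ?_
  set Φ := ((logBasis K).equivFunL : logSpace K →L[ℝ] (Fin (rank K) → ℝ)) with hΦ
  have hcoord : ∀ i, |coneCoord x i - coneCoord y i| ≤ ‖Φ‖ * ‖logMap x - logMap y‖ := by
    intro i
    have h1 : coneCoord x i - coneCoord y i = (Φ (logMap x - logMap y)) i := by
      rw [map_sub]; rfl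
    rw [h1, ← Real.norm_eq_abs]
    exact (norm_le_pi_norm _ i).trans (Φ.le_opNorm _)
  have hlog := norm_logMap_sub_logMap_le hη hx hy
  have hsum : |∑ i, m i * coneCoord x i - ∑ i, m i * coneCoord y i| ≤
      (∑ i, |m i|) * (‖Φ‖ * (4 * (‖x - y‖ / η))) := by
    rw [← Finset.sum_sub_distrib]
    calc |∑ i, (m i * coneCoord x i - m i * coneCoord y i)|
        ≤ ∑ i, |m i * coneCoord x i - m i * coneCoord y i| := Finset.abs_sum_le_sum_abs _ _
      _ ≤ ∑ i, |m i| * (‖Φ‖ * (4 * (‖x - y‖ / η))) := by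
          refine Finset.sum_le_sum fun i _ ↦ ?_
          rw [← mul_sub, abs_mul]
          refine mul_le_mul_of_nonneg_left ?_ (abs_nonneg _)
          exact (hcoord i).trans (mul_le_mul_of_nonneg_left hlog (norm_nonneg _))
      _ = (∑ i, |m i|) * (‖Φ‖ * (4 * (‖x - y‖ / η))) := by rw [Finset.sum_mul]
  calc 2 * π * |∑ i, m i * coneCoord x i - ∑ i, m i * coneCoord y i|
      ≤ 2 * π * ((∑ i, |m i|) * (‖Φ‖ * (4 * (‖x - y‖ / η)))) :=
        mul_le_mul_of_nonneg_left hsum (by positivity)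
    _ = twistLip m * (‖x - y‖ / η) := by rw [twistLip, hΦ]; ring

/-! ## The sign parts of the norm-one domain -/

variable (K) in
/-- **The sign part `X_s`** of Mathlib's norm-one fundamental domain: the points of `normLeOne K`
whose real coordinates are negative exactly at the places of `s` (`negAt s '' plusPart`).
[cite: Marcus2018, Ch. 6, p. 128 (the signs at the real places)] -/
def signPart (s : Set {w : InfinitePlace K // IsReal w}) : Set (mixedSpace K) :=
  negAt s '' plusPart (normLeOne K)

/-- Flipping signs of real coordinates preserves the fundamental cone. [folklore] -/
theorem negAt_mem_fundamentalCone_iff (s : Set {w : InfinitePlace K // IsReal w}) {x : mixedSpace K} :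
    negAt s x ∈ fundamentalCone K ↔ x ∈ fundamentalCone K := by
  simp only [fundamentalCone, Set.mem_sdiff, Set.mem_preimage, Set.mem_setOf_eq,
    logMap_eq_of_normAtPlace_eq (normAtPlace_negAt (s := s) x), norm_negAt]

/-- Flipping signs of real coordinates preserves `normLeOne K`. [folklore] -/
theorem negAt_mem_normLeOne_iff (s : Set {w : InfinitePlace K // IsReal w}) {x : mixedSpace K} :
    negAt s x ∈ normLeOne K ↔ x ∈ normLeOne K := by
  rw [mem_normLeOne, mem_normLeOne, negAt_mem_fundamentalCone_iff, norm_negAt]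

/-- `negAt s '' normLeOne K = normLeOne K`. [folklore] -/
theorem negAt_image_normLeOne (s : Set {w : InfinitePlace K // IsReal w}) :
    negAt s '' normLeOne K = normLeOne K := by
  ext x
  constructor
  · rintro ⟨y, hy, rfl⟩; exact (negAt_mem_normLeOne_iff s).2 hy
  · intro hx
    refine ⟨negAt s x, (negAt_mem_normLeOne_iff s).2 hx, ?_⟩
    have h := (negAt s).apply_symm_apply x
    rwa [negAt_symm] at h

/-- A sign part lies in `normLeOne K`. [folklore] -/
theorem signPart_subset_normLeOne (s : Set {w : InfinitePlace K // IsReal w}) :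
    signPart K s ⊆ normLeOne K := by
  rintro _ ⟨y, hy, rfl⟩
  exact (negAt_mem_normLeOne_iff s).2 hy.1

/-- A sign part lies in the fundamental cone. [folklore] -/
theorem signPart_subset_fundamentalCone (s : Set {w : InfinitePlace K // IsReal w}) :
    signPart K s ⊆ fundamentalCone K :=
  (signPart_subset_normLeOne s).trans fun _ hx ↦ hx.1

/-- The sign parts are bounded. [folklore] -/
theorem isBounded_signPart (s : Set {w : InfinitePlace K // IsReal w}) : IsBounded (signPart K s) :=
  (isBounded_normLeOne K).subset (signPart_subset_normLeOne s)

/-- The sign parts are measurable. [folklore] -/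
theorem measurableSet_signPart (s : Set {w : InfinitePlace K // IsReal w}) :
    MeasurableSet (signPart K s) :=
  measurableSet_negAt_plusPart s _ (measurableSet_normLeOne K)

/-- **The frontier of the positive part lies in the frontier**: for a set `A` of the mixed space
all of whose points have nonzero real coordinates, `frontier (plusPart A) ⊆ frontier A`.
[folklore] -/
theorem frontier_plusPart_subset {A : Set (mixedSpace K)} (hA : ∀ x ∈ A, ∀ w, x.1 w ≠ 0) :
    frontier (plusPart A) ⊆ frontier A := by
  intro z hz
  set O : Set (mixedSpace K) := {x | ∀ w, 0 < x.1 w} with hO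
  have hOopen : IsOpen O := by
    rw [hO, show {x : mixedSpace K | ∀ w, 0 < x.1 w} = ⋂ w, {x | 0 < x.1 w} by ext; simp]
    exact isOpen_iInter_of_finite fun w ↦ isOpen_lt continuous_const (by fun_prop)
  have hcl : z ∈ closure A := closure_mono Set.inter_subset_left hz.1
  refine ⟨hcl, fun hint ↦ ?_⟩
  -- `z ∈ interior A`; then `z ∉ O` (else `z ∈ interior (A ∩ O)`), so some coordinate vanishes
  have hzO : z ∉ O := by
    intro hzO
    apply hz.2
    rw [interior_inter, hOopen.interior_eq]
    exact ⟨hint, hzO⟩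
  have hnonneg : ∀ w, 0 ≤ z.1 w := by
    have hsub : closure (plusPart A) ⊆ {x : mixedSpace K | ∀ w, 0 ≤ x.1 w} := by
      refine closure_minimal (fun x hx w ↦ (hx.2 w).le) ?_
      rw [show {x : mixedSpace K | ∀ w, 0 ≤ x.1 w} = ⋂ w, {x | 0 ≤ x.1 w} by ext; simp]
      exact isClosed_iInter fun w ↦ isClosed_le continuous_const (by fun_prop)
    exact hsub hz.1
  obtain ⟨w, hw⟩ : ∃ w, z.1 w = 0 := by
    by_contra h
    push Not at h
    exact hzO fun w ↦ lt_of_le_of_ne (hnonneg w) (Ne.symm (h w))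
  exact hA z (interior_subset hint) w hw

/-- Points of `normLeOne K` have nonzero real coordinates. [folklore] -/
theorem fst_ne_zero_of_mem_normLeOne {x : mixedSpace K} (hx : x ∈ normLeOne K)
    (w : {w : InfinitePlace K // IsReal w}) : x.1 w ≠ 0 := by
  have h := normAtPlace_pos_of_mem hx.1 w.1
  rw [normAtPlace_apply_of_isReal w.2] at h
  exact norm_pos_iff.1 h

/-- **The frontier of a sign part lies in the frontier of `normLeOne K`.** [folklore] -/
theorem frontier_signPart_subset (s : Set {w : InfinitePlace K // IsReal w}) :
    frontier (signPart K s) ⊆ frontier (normLeOne K) := by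
  have hhom : ∀ A : Set (mixedSpace K), (negAt s) '' frontier A = frontier ((negAt s) '' A) :=
    fun A ↦ (negAt s).toHomeomorph.image_frontier A
  unfold signPart
  rw [← hhom]
  calc (negAt s) '' frontier (plusPart (normLeOne K)) ⊆ (negAt s) '' frontier (normLeOne K) :=
        Set.image_mono (frontier_plusPart_subset fun x hx w ↦ fst_ne_zero_of_mem_normLeOne hx w)
    _ = frontier ((negAt s) '' normLeOne K) := hhom _
    _ = frontier (normLeOne K) := by rw [negAt_image_normLeOne]

/-- `LipschitzFrontier` is monotone with respect to inclusion of frontiers (a local copy of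
`LipschitzFrontier.of_frontier_subset` of `RayClassLSeriesAtOneProofs.lean`, not imported here).
[folklore] -/
private theorem lipschitzFrontier_of_frontier_subset
    {E : Type*} [NormedAddCommGroup E] [NormedSpace ℝ E] {X Y : Set E}
    (hY : Literature.Algebra.EuclideanLattices.LipschitzFrontier Y) (h : frontier X ⊆ frontier Y) :
    Literature.Algebra.EuclideanLattices.LipschitzFrontier X := by
  obtain ⟨m, N, L, f, hm, hf, hcov⟩ := hY
  exact ⟨m, N, L, f, hm, hf, h.trans hcov⟩

/-- **The frontier of a sign part is Lipschitz parametrizable.** [cite: Marcus2018, Ch. 6, pp. 127–129] -/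
theorem lipschitzFrontier_signPart (s : Set {w : InfinitePlace K // IsReal w}) :
    Literature.Algebra.EuclideanLattices.LipschitzFrontier (signPart K s) :=
  lipschitzFrontier_of_frontier_subset (NumberField.lipschitzFrontier_normLeOne (K := K))
    (frontier_signPart_subset s)

/-- Points of a dilate `t • X_s` (`t > 0`) lie in the fundamental cone. [folklore] -/
theorem mem_fundamentalCone_of_mem_smul_signPart {s : Set {w : InfinitePlace K // IsReal w}} {t : ℝ}
    (ht : 0 < t) {x : mixedSpace K} (hx : x ∈ t • signPart K s) : x ∈ fundamentalCone K := by
  rw [Set.mem_smul_set_iff_inv_smul_mem₀ ht.ne'] at hx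
  have := signPart_subset_fundamentalCone s hx
  rwa [smul_mem_iff_mem (inv_ne_zero ht.ne')] at this

variable (K) in
/-- **The twisted cone integral** `V_s(m) = ∫_{X_s} e_m`. [cite: Mitsui1956, §1] -/
def twistIntegral (s : Set {w : InfinitePlace K // IsReal w}) (m : Fin (rank K) → ℝ) : ℂ :=
  ∫ x in signPart K s, eTwist m x

/-- `e_m` is integrable on every bounded measurable set. [folklore] -/
theorem integrableOn_eTwist (m : Fin (rank K) → ℝ) {S : Set (mixedSpace K)} (hS₁ : IsBounded S) :
    IntegrableOn (eTwist m) S volume := by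
  have hfin : volume S < ⊤ := hS₁.measure_lt_top
  refine Integrable.mono' (integrableOn_const (C := (1 : ℝ)) hfin.ne (by simp))
    (measurable_eTwist m).aestronglyMeasurable (Filter.Eventually.of_forall fun x ↦ ?_)
  exact (norm_eTwist m x).le

/-- `∫_{t • X_s} e_m = t^d V_s(m)` (`e_m` is invariant under positive scalings on the cone).
[folklore] -/
theorem setIntegral_smul_signPart (s : Set {w : InfinitePlace K // IsReal w}) (m : Fin (rank K) → ℝ)
    {t : ℝ} (ht : 0 < t) :
    ∫ x in t • signPart K s, eTwist m x = (t ^ finrank ℚ K : ℝ) * twistIntegral K s m := by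
  have h := Measure.setIntegral_comp_smul_of_pos volume (eTwist m) (signPart K s) ht
  rw [mixedEmbedding.finrank] at h
  have hcongr : ∫ x in signPart K s, eTwist m (t • x) = ∫ x in signPart K s, eTwist m x := by
    refine setIntegral_congr_fun (measurableSet_signPart s) fun x hx ↦ ?_
    exact eTwist_smul m (norm_pos_of_mem (signPart_subset_fundamentalCone s hx)).ne' ht.ne'
  rw [hcongr] at h
  have htn : (t ^ finrank ℚ K : ℝ) ≠ 0 := pow_ne_zero _ ht.ne'
  rw [twistIntegral, h, ← Complex.coe_smul, smul_eq_mul, ← mul_assoc]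
  push_cast
  rw [mul_inv_cancel₀ (by exact_mod_cast htn), one_mul]

/-! ## Lattice points in a ball -/

section Ball

variable {E : Type*} [NormedAddCommGroup E] [NormedSpace ℝ E] [MeasurableSpace E] [BorelSpace E]
  [FiniteDimensional ℝ E] {ι : Type*} [Fintype ι] (b : Basis ι ℝ E) (μ : Measure E) [μ.IsAddHaarMeasure]

/-- **Lattice points in a ball**: `#{ℓ ∈ T} ≤ (r + 2R_b)^n μ(B(0,1))/μ(P)` for a finite set `T` of
lattice points of norm `≤ r` (`r ≥ 0`). [cite: Marcus2018, Ch. 6, proof of Lemma 2] -/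
theorem card_le_of_norm_le {T : Finset E} (hT : ∀ ℓ ∈ T, ℓ ∈ span ℤ (Set.range b)) {r : ℝ}
    (hr : 0 ≤ r) (hTr : ∀ ℓ ∈ T, ‖ℓ‖ ≤ r) :
    (T.card : ℝ) ≤ (r + 2 * Literature.Algebra.EuclideanLattices.cellRadius b) ^ finrank ℝ E *
      μ.real (closedBall (0 : E) 1) / μ.real (ZSpan.fundamentalDomain b) := by
  have h := Literature.Algebra.EuclideanLattices.card_le_of_cell_inter_closedBall b μ hT
    (y := 0) (r := r) fun ℓ hℓ ↦ ⟨ℓ, Literature.Algebra.EuclideanLattices.self_mem_cell b (hT ℓ hℓ),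
      by rw [mem_closedBall, dist_zero_right]; exact hTr ℓ hℓ⟩
  have hR := Literature.Algebra.EuclideanLattices.cellRadius_nonneg b
  have hvol : μ.real (closedBall (0 : E) (r + 2 * Literature.Algebra.EuclideanLattices.cellRadius b)) =
      (r + 2 * Literature.Algebra.EuclideanLattices.cellRadius b) ^ finrank ℝ E *
        μ.real (closedBall (0 : E) 1) := by
    rw [measureReal_def, Measure.addHaar_closedBall' μ (0 : E) (by positivity), ENNReal.toReal_mul,
      ENNReal.toReal_ofReal (by positivity), measureReal_def]
  rwa [hvol] at h

end Ball

/-! ## The twisted count -/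

/-- The oscillation majorant used in the twisted count: `2` on the lattice points of norm `≤ θ`,
`2 A R_b/(c θ)` beyond. [folklore] -/
def oscFun (A c Rb θ : ℝ) (ℓ : mixedSpace K) : ℝ := if ‖ℓ‖ ≤ θ then 2 else 2 * A * Rb / (c * θ)

/-- The oscillation majorant is nonnegative. [folklore] -/
theorem oscFun_nonneg {A c Rb θ : ℝ} (hA : 0 ≤ A) (hc : 0 ≤ c) (hRb : 0 ≤ Rb) (hθ : 0 ≤ θ)
    (ℓ : mixedSpace K) : 0 ≤ oscFun A c Rb θ ℓ := by
  unfold oscFun; split_ifs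
  · norm_num
  · positivity

/-- **Oscillation of the twist on a cell inside a dilated sign part**: with `θ ≥ 2R_b`, `θ > 0`,
for a lattice point `ℓ` whose cell `ℓ + P ⊆ t • X_s` and `x ∈ ℓ + P`,
`‖e_m(x) − e_m(ℓ)‖ ≤ oscFun A_m c_K R_b θ ℓ`. [cite: Mitsui1956, §1] -/
theorem norm_eTwist_sub_le_oscFun {ι : Type*} [Fintype ι] (b : Basis ι ℝ (mixedSpace K))
    (m : Fin (rank K) → ℝ) {s : Set {w : InfinitePlace K // IsReal w}} {t : ℝ} (ht : 0 < t)
    {θ : ℝ} (hθ0 : 0 < θ) (hθ : 2 * Literature.Algebra.EuclideanLattices.cellRadius b ≤ θ)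
    {ℓ : mixedSpace K} (hcell : Literature.Algebra.EuclideanLattices.cell b ℓ ⊆ t • signPart K s)
    (hℓ : ℓ ∈ t • signPart K s) {x : mixedSpace K} (hx : x ∈ Literature.Algebra.EuclideanLattices.cell b ℓ) :
    ‖eTwist m x - eTwist m ℓ‖ ≤
      oscFun (twistLip m) (coneConst K) (Literature.Algebra.EuclideanLattices.cellRadius b) θ ℓ := by
  set Rb := Literature.Algebra.EuclideanLattices.cellRadius b with hRb
  have hRb0 : 0 ≤ Rb := Literature.Algebra.EuclideanLattices.cellRadius_nonneg b
  set c := coneConst K with hc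
  have hcpos : 0 < c := coneConst_pos
  set A := twistLip (K := K) m with hA
  have hA0 : 0 ≤ A := twistLip_nonneg m
  unfold oscFun
  split_ifs with hnear
  · calc ‖eTwist m x - eTwist m ℓ‖ ≤ ‖eTwist m x‖ + ‖eTwist m ℓ‖ := norm_sub_le _ _
      _ = 2 := by rw [norm_eTwist, norm_eTwist]; norm_num
  · push Not at hnear
    have hxS : x ∈ t • signPart K s := hcell hx
    have hxℓ : ‖x - ℓ‖ ≤ Rb := Literature.Algebra.EuclideanLattices.norm_sub_le_of_mem_cell b hx
    have hℓbig : 2 * Rb ≤ ‖ℓ‖ := by linarith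
    have hxnorm : ‖ℓ‖ / 2 ≤ ‖x‖ := by
      have := norm_sub_norm_le ℓ x
      rw [norm_sub_rev] at this
      linarith
    have hℓpos : 0 < ‖ℓ‖ := by linarith
    set η : ℝ := c * (‖ℓ‖ / 2) with hη
    have hηpos : 0 < η := by positivity
    have hxc : ∀ w, η ≤ normAtPlace w x := fun w ↦
      (mul_le_mul_of_nonneg_left hxnorm hcpos.le).trans
        (coneConst_mul_norm_le_normAtPlace (mem_fundamentalCone_of_mem_smul_signPart ht hxS) w)
    have hℓc : ∀ w, η ≤ normAtPlace w ℓ := fun w ↦ by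
      have h1 := coneConst_mul_norm_le_normAtPlace (mem_fundamentalCone_of_mem_smul_signPart ht hℓ) w
      have h2 : c * (‖ℓ‖ / 2) ≤ c * ‖ℓ‖ := by nlinarith
      linarith
    have hRη : Rb / η = 2 * Rb / (c * ‖ℓ‖) := by rw [hη]; field_simp
    calc ‖eTwist m x - eTwist m ℓ‖ ≤ A * (‖x - ℓ‖ / η) := norm_eTwist_sub_eTwist_le m hηpos hxc hℓc
      _ ≤ A * (Rb / η) := by gcongr
      _ = 2 * A * Rb / (c * ‖ℓ‖) := by rw [hRη]; ring
      _ ≤ 2 * A * Rb / (c * θ) := by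
          apply div_le_div_of_nonneg_left (by positivity) (by positivity)
          exact mul_le_mul_of_nonneg_left hnear.le hcpos.le

/-- **The sum of the oscillation majorant** over the lattice points of `t • X_s`, with
`θ = ρ₀ √t`: `≤ C₁ t^{n/2} + C₂ t^{n − 1/2}` with explicit `C₁, C₂`. [folklore] -/
theorem sum_oscFun_le {ι : Type*} [Fintype ι] (b : Basis ι ℝ (mixedSpace K)) (A c : ℝ) (hA : 0 ≤ A)
    (hc : 0 < c) {s : Set {w : InfinitePlace K // IsReal w}} {RS : ℝ} (hRS0 : 0 < RS)
    (hRS : signPart K s ⊆ closedBall 0 RS) {ρ₀ : ℝ} (hρ₀ : 0 < ρ₀) {t : ℝ} (ht : 1 ≤ t)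
    {T : Finset (mixedSpace K)} (hT : ∀ x, x ∈ T → x ∈ t • signPart K s ∧ x ∈ span ℤ (Set.range b)) :
    ∑ ℓ ∈ T, oscFun A c (Literature.Algebra.EuclideanLattices.cellRadius b) (ρ₀ * Real.sqrt t) ℓ ≤
      (2 * ((ρ₀ + 2 * Literature.Algebra.EuclideanLattices.cellRadius b) ^ finrank ℚ K *
          volume.real (closedBall (0 : mixedSpace K) 1) / volume.real (ZSpan.fundamentalDomain b))) *
        t ^ ((finrank ℚ K : ℝ) / 2) +
      ((2 * A * Literature.Algebra.EuclideanLattices.cellRadius b / (c * ρ₀)) *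
          ((RS + 2 * Literature.Algebra.EuclideanLattices.cellRadius b) ^ finrank ℚ K *
            volume.real (closedBall (0 : mixedSpace K) 1) / volume.real (ZSpan.fundamentalDomain b))) *
        t ^ ((finrank ℚ K : ℝ) - 1 / 2) := by
  set Rb := Literature.Algebra.EuclideanLattices.cellRadius b with hRb
  have hRb0 : 0 ≤ Rb := Literature.Algebra.EuclideanLattices.cellRadius_nonneg b
  set P : ℝ := volume.real (ZSpan.fundamentalDomain b) with hP
  have hPpos : 0 < P := Literature.Algebra.EuclideanLattices.measureReal_fundamentalDomain_pos b volume
  set VB : ℝ := volume.real (closedBall (0 : mixedSpace K) 1) with hVB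
  have hVB0 : 0 ≤ VB := measureReal_nonneg
  set n : ℕ := finrank ℚ K with hn
  have hnE : finrank ℝ (mixedSpace K) = n := mixedEmbedding.finrank K
  have ht0 : 0 < t := by linarith
  have hsqt1 : 1 ≤ Real.sqrt t := by rw [← Real.sqrt_one]; exact Real.sqrt_le_sqrt ht
  set θ : ℝ := ρ₀ * Real.sqrt t with hθ
  have hθ0 : 0 < θ := by positivity
  have hTΛ : ∀ ℓ ∈ T, ℓ ∈ span ℤ (Set.range b) := fun ℓ hℓ ↦ (hT ℓ hℓ).2
  have hSball : ∀ x ∈ T, ‖x‖ ≤ RS * t := by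
    intro x hx
    obtain ⟨y, hy, rfl⟩ := Set.mem_smul_set.1 (hT x hx).1
    have := hRS hy
    rw [mem_closedBall, dist_zero_right] at this
    rw [_root_.norm_smul, Real.norm_of_nonneg ht0.le]
    nlinarith [norm_nonneg y]
  set Tn := T.filter fun ℓ ↦ ‖ℓ‖ ≤ θ with hTn
  set Tf := T.filter fun ℓ ↦ ¬ ‖ℓ‖ ≤ θ with hTf
  have hsplit : ∑ ℓ ∈ T, oscFun A c Rb θ ℓ = ∑ ℓ ∈ Tn, oscFun A c Rb θ ℓ + ∑ ℓ ∈ Tf, oscFun A c Rb θ ℓ :=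
    (Finset.sum_filter_add_sum_filter_not T (fun ℓ ↦ ‖ℓ‖ ≤ θ) _).symm
  have hnear : ∑ ℓ ∈ Tn, oscFun A c Rb θ ℓ = 2 * Tn.card := by
    rw [Finset.sum_congr rfl (g := fun _ ↦ (2 : ℝ)) fun ℓ hℓ ↦ by
      unfold oscFun; rw [if_pos (Finset.mem_filter.1 hℓ).2]]
    rw [Finset.sum_const, nsmul_eq_mul, mul_comm]
  have hfar : ∑ ℓ ∈ Tf, oscFun A c Rb θ ℓ = (2 * A * Rb / (c * θ)) * Tf.card := by
    rw [Finset.sum_congr rfl (g := fun _ ↦ 2 * A * Rb / (c * θ)) fun ℓ hℓ ↦ by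
      unfold oscFun; rw [if_neg (Finset.mem_filter.1 hℓ).2]]
    rw [Finset.sum_const, nsmul_eq_mul, mul_comm]
  have hcardn : (Tn.card : ℝ) ≤ (θ + 2 * Rb) ^ n * VB / P := by
    have := card_le_of_norm_le b volume (T := Tn) (fun ℓ hℓ ↦ hTΛ ℓ (Finset.mem_filter.1 hℓ).1)
      (r := θ) hθ0.le (fun ℓ hℓ ↦ (Finset.mem_filter.1 hℓ).2)
    rwa [hnE] at this
  have hcardf : (Tf.card : ℝ) ≤ (RS * t + 2 * Rb) ^ n * VB / P := by
    have h1 : (Tf.card : ℝ) ≤ T.card := by exact_mod_cast Finset.card_filter_le _ _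
    have h2 := card_le_of_norm_le b volume (T := T) hTΛ (r := RS * t) (by positivity) hSball
    rw [hnE] at h2
    exact h1.trans h2
  have hθt : θ + 2 * Rb ≤ (ρ₀ + 2 * Rb) * Real.sqrt t := by
    rw [hθ, add_mul]; nlinarith
  have hsqrt_pow : Real.sqrt t ^ n = t ^ ((n : ℝ) / 2) := by
    rw [Real.sqrt_eq_rpow, ← Real.rpow_natCast, ← Real.rpow_mul ht0.le]
    congr 1; ring
  have hpow1 : (θ + 2 * Rb) ^ n ≤ (ρ₀ + 2 * Rb) ^ n * t ^ ((n : ℝ) / 2) := by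
    calc (θ + 2 * Rb) ^ n ≤ ((ρ₀ + 2 * Rb) * Real.sqrt t) ^ n :=
          pow_le_pow_left₀ (by positivity) hθt n
      _ = (ρ₀ + 2 * Rb) ^ n * t ^ ((n : ℝ) / 2) := by rw [mul_pow, hsqrt_pow]
  have hRSt : RS * t + 2 * Rb ≤ (RS + 2 * Rb) * t := by rw [add_mul]; nlinarith
  have hpow2 : (RS * t + 2 * Rb) ^ n ≤ (RS + 2 * Rb) ^ n * t ^ n := by
    calc (RS * t + 2 * Rb) ^ n ≤ ((RS + 2 * Rb) * t) ^ n := pow_le_pow_left₀ (by positivity) hRSt n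
      _ = (RS + 2 * Rb) ^ n * t ^ n := mul_pow _ _ _
  have htn : (t : ℝ) ^ n = Real.sqrt t * t ^ ((n : ℝ) - 1 / 2) := by
    rw [Real.sqrt_eq_rpow, ← Real.rpow_natCast, ← Real.rpow_add ht0]; congr 1; ring
  have hθinv : (2 * A * Rb / (c * θ)) * t ^ n = (2 * A * Rb / (c * ρ₀)) * t ^ ((n : ℝ) - 1 / 2) := by
    rw [htn, hθ]
    have hne : Real.sqrt t ≠ 0 := by positivity
    field_simp
  calc ∑ ℓ ∈ T, oscFun A c Rb θ ℓ = 2 * Tn.card + (2 * A * Rb / (c * θ)) * Tf.card := by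
        rw [hsplit, hnear, hfar]
    _ ≤ 2 * ((θ + 2 * Rb) ^ n * VB / P) + (2 * A * Rb / (c * θ)) * ((RS * t + 2 * Rb) ^ n * VB / P) := by
        gcongr
    _ ≤ 2 * ((ρ₀ + 2 * Rb) ^ n * t ^ ((n : ℝ) / 2) * VB / P) +
          (2 * A * Rb / (c * θ)) * ((RS + 2 * Rb) ^ n * t ^ n * VB / P) := by
        gcongr
    _ = (2 * ((ρ₀ + 2 * Rb) ^ n * VB / P)) * t ^ ((n : ℝ) / 2) +
          (((2 * A * Rb / (c * θ)) * t ^ n) * ((RS + 2 * Rb) ^ n * VB / P)) := by ring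
    _ = _ := by rw [hθinv]; ring

/-- **Twisted lattice sums over a dilated sign part of the cone** (the lattice-point input of
Hecke's and Mitsui's prime number theorem with Grössencharakteren): for a full lattice `L` of
the mixed space, a set `s` of real places and a frequency `m`, there is `C` such that for all
`t ≥ 1` and the finite set `T = L ∩ t • X_s`,
`‖∑_{ℓ ∈ T} e_m(ℓ) − (V_s(m)/covol L) t^d‖ ≤ C t^{d − 1/2}`.
[cite: Mitsui1956, §1; Marcus2018, Ch. 6, Lemma 2] -/
theorem norm_sum_eTwist_sub_le (L : Submodule ℤ (mixedSpace K)) [DiscreteTopology L] [IsZLattice ℝ L]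
    (s : Set {w : InfinitePlace K // IsReal w}) (m : Fin (rank K) → ℝ) :
    ∃ C : ℝ, ∀ t : ℝ, 1 ≤ t → ∀ T : Finset (mixedSpace K),
      (∀ x, x ∈ T ↔ x ∈ t • signPart K s ∧ x ∈ L) →
        ‖(∑ x ∈ T, eTwist m x) - twistIntegral K s m / ZLattice.covolume L * (t ^ finrank ℚ K : ℝ)‖ ≤
          C * t ^ ((finrank ℚ K : ℝ) - 1 / 2) := by
  -- the basis of `L` and its cells
  set b₀ := Module.Free.chooseBasis ℤ L
  set b := b₀.ofZLatticeBasis ℝ L with hb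
  have hspan : span ℤ (Set.range b) = L := b₀.ofZLatticeBasis_span ℝ
  have hcov : ZLattice.covolume L volume = volume.real (ZSpan.fundamentalDomain b) :=
    ZLattice.covolume_eq_measure_fundamentalDomain L volume (ZLattice.isAddFundamentalDomain b₀ volume)
  have hPpos : 0 < volume.real (ZSpan.fundamentalDomain b) :=
    Literature.Algebra.EuclideanLattices.measureReal_fundamentalDomain_pos b volume
  set Rb := Literature.Algebra.EuclideanLattices.cellRadius b with hRb
  have hRb0 : 0 ≤ Rb := Literature.Algebra.EuclideanLattices.cellRadius_nonneg b
  set n : ℕ := finrank ℚ K with hn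
  have hnE : finrank ℝ (mixedSpace K) = n := mixedEmbedding.finrank K
  have hn1 : 1 ≤ n := finrank_pos
  -- the frontier cover
  obtain ⟨C₀, hC₀⟩ := (lipschitzFrontier_signPart (K := K) s).exists_cover
  -- a ball containing the sign part
  obtain ⟨RS, hRS0, hRS⟩ : ∃ R : ℝ, 0 < R ∧ signPart K s ⊆ closedBall 0 R := by
    obtain ⟨R, hR⟩ := (isBounded_signPart (K := K) s).subset_closedBall 0
    exact ⟨max R 1, by positivity, hR.trans (closedBall_subset_closedBall (le_max_left _ _))⟩
  -- constants
  have hcpos : 0 < coneConst K := coneConst_pos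
  have hA0 : 0 ≤ twistLip (K := K) m := twistLip_nonneg m
  set ρ₀ : ℝ := max 1 (2 * Rb) with hρ₀
  have hρ₀1 : 1 ≤ ρ₀ := le_max_left _ _
  have hρ₀2 : 2 * Rb ≤ ρ₀ := le_max_right _ _
  set MB : ℝ := volume.real (closedBall (0 : mixedSpace K) (1 + 2 * Rb)) /
    volume.real (ZSpan.fundamentalDomain b) with hMB
  have hMB0 : 0 ≤ MB := div_nonneg measureReal_nonneg hPpos.le
  set C₁ : ℝ := 2 * ((ρ₀ + 2 * Rb) ^ n * volume.real (closedBall (0 : mixedSpace K) 1) /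
    volume.real (ZSpan.fundamentalDomain b)) with hC₁
  set C₂ : ℝ := (2 * twistLip m * Rb / (coneConst K * ρ₀)) *
    ((RS + 2 * Rb) ^ n * volume.real (closedBall (0 : mixedSpace K) 1) /
      volume.real (ZSpan.fundamentalDomain b)) with hC₂
  set C₃ : ℝ := 2 * (C₀ * MB) with hC₃
  have hC₁0 : 0 ≤ C₁ := by positivity
  refine ⟨C₁ + C₂ + |C₃|, fun t ht T hT ↦ ?_⟩
  have ht0 : 0 < t := by linarith
  have hsqt1 : 1 ≤ Real.sqrt t := by rw [← Real.sqrt_one]; exact Real.sqrt_le_sqrt ht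
  set S : Set (mixedSpace K) := t • signPart K s with hS
  have hS₁ : IsBounded S := (isBounded_signPart s).smul₀ t
  have hS₂ : MeasurableSet S := (measurableSet_signPart s).const_smul₀ t
  have hT' : ∀ x, x ∈ T ↔ x ∈ S ∧ x ∈ span ℤ (Set.range b) := by
    intro x; rw [hT x, hspan]
  -- the cover at `t`
  obtain ⟨Y, hYcard, hYcov⟩ := hC₀ t ht
  rw [hnE] at hYcard
  -- the oscillation function
  set θ : ℝ := ρ₀ * Real.sqrt t with hθ
  have hθ1 : ρ₀ ≤ θ := by rw [hθ]; exact le_mul_of_one_le_right (by linarith) hsqt1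
  have hθ0 : 0 < θ := by positivity
  have hosc0 : ∀ ℓ ∈ T, 0 ≤ oscFun (twistLip m) (coneConst K) Rb θ ℓ := fun ℓ _ ↦
    oscFun_nonneg hA0 hcpos.le hRb0 hθ0.le ℓ
  have hosc : ∀ ℓ ∈ T, Literature.Algebra.EuclideanLattices.cell b ℓ ⊆ S →
      ∀ x ∈ Literature.Algebra.EuclideanLattices.cell b ℓ,
        ‖eTwist m x - eTwist m ℓ‖ ≤ oscFun (twistLip m) (coneConst K) Rb θ ℓ :=
    fun ℓ hℓ hcell x hx ↦ norm_eTwist_sub_le_oscFun b m ht0 hθ0 (hρ₀2.trans hθ1) hcell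
      ((hT' ℓ).1 hℓ).1 hx
  -- apply the weighted count
  have hmain := Literature.Algebra.EuclideanLattices.norm_sum_sub_integral_le_of_cover b volume hS₁ hS₂
    hT' hYcov (integrableOn_eTwist m hS₁) zero_le_one (fun x _ ↦ (norm_eTwist m x).le) hosc0 hosc
  -- the main term
  have hint : (((volume.real (ZSpan.fundamentalDomain b))⁻¹ : ℝ) : ℂ) * ∫ x in S, eTwist m x =
      twistIntegral K s m / ZLattice.covolume L * (t ^ finrank ℚ K : ℝ) := by
    rw [hS, setIntegral_smul_signPart s m ht0, hcov]
    push_cast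
    ring
  rw [hint] at hmain
  -- the oscillation sum
  have hsum_osc := sum_oscFun_le b (twistLip m) (coneConst K) hA0 hcpos hRS0 hRS (lt_of_lt_of_le one_pos hρ₀1)
    ht (T := T) (fun x hx ↦ (hT' x).1 hx)
  rw [← hC₁, ← hC₂] at hsum_osc
  -- comparison of exponents for `t ≥ 1`
  have hexp1 : t ^ ((n : ℝ) / 2) ≤ t ^ ((n : ℝ) - 1 / 2) := by
    apply Real.rpow_le_rpow_of_exponent_le ht
    have : (1 : ℝ) ≤ n := by exact_mod_cast hn1
    linarith
  have hexp2 : (t ^ (n - 1) : ℝ) ≤ t ^ ((n : ℝ) - 1 / 2) := by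
    rw [← Real.rpow_natCast, Nat.cast_sub hn1, Nat.cast_one]
    apply Real.rpow_le_rpow_of_exponent_le ht; linarith
  -- the frontier term
  have hfront : 2 * (1 : ℝ) * (Y.card * MB) ≤ |C₃| * t ^ ((n : ℝ) - 1 / 2) := by
    calc 2 * (1 : ℝ) * (Y.card * MB) ≤ 2 * (C₀ * t ^ (n - 1) * MB) := by
          rw [mul_one]; gcongr
      _ = C₃ * t ^ (n - 1) := by rw [hC₃]; ring
      _ ≤ |C₃| * t ^ (n - 1) := by gcongr; exact le_abs_self _
      _ ≤ |C₃| * t ^ ((n : ℝ) - 1 / 2) := mul_le_mul_of_nonneg_left hexp2 (abs_nonneg _)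
  calc _ ≤ 2 * (1 : ℝ) * (Y.card * MB) + ∑ ℓ ∈ T, oscFun (twistLip m) (coneConst K) Rb θ ℓ := hmain
    _ ≤ |C₃| * t ^ ((n : ℝ) - 1 / 2) + (C₁ * t ^ ((n : ℝ) / 2) + C₂ * t ^ ((n : ℝ) - 1 / 2)) :=
        add_le_add hfront hsum_osc
    _ ≤ |C₃| * t ^ ((n : ℝ) - 1 / 2) + (C₁ * t ^ ((n : ℝ) - 1 / 2) + C₂ * t ^ ((n : ℝ) - 1 / 2)) := by
        gcongr
    _ = (C₁ + C₂ + |C₃|) * t ^ ((n : ℝ) - 1 / 2) := by ring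

end Literature.NumberTheory.LFunctions.HeckeCone

end
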